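import Summits.Ventures.HodgeRepro2.T6N3SideA
import Summits.Ventures.HodgeRepro2.T6N3Iso

/-!
# T6N3Assembly — the three N3 statements of the M2 contract, over the N3 datum (TARGET-T6 §9.3)

Cell pub-hodge-repro2, Tier 6 (README §10), seat t6-p3 (N3 owner, M2). Proof lane. The lead's
composition carrier `NAut` (§9.2(b)) takes `iA := d3.A.hypI`, `iiA := d3.A.hypII`, `ellA := d3.ellNonzero
d3.A` (and B likewise); the three theorems below are the N3 field statements of the Tier-5 spine
`T5Assembly.AssemblyCore` (N3A, N3B, N3iso) over the datum, with the interface Props of T6N3Interface as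
explicit binders — each a declared residual of class AD at M2 (§9.5) unless discharged or displayed +
bridged. `T6N3Main.lean` instantiates them on `(P : NDatum F) (M : NAut F P)` the hour `NAut` lands.

§8(d): uses an L-value-free non-vanishing device: NO.
-/

namespace Summit.Ventures.HodgeRepro2.T6.N3Datum

open scoped InnerProductSpace

variable (𝒟 : N3Datum)

/-- N3A (TIER5 Proposition N*, side A): `(i) ∧ (ii) ⟹ ℓ_A^σ ≢ 0 on σ^τ for a single product of vertex
forms`, over the datum, with the 20 interface binders of side A. -/
theorem N3A_of_datum (hKC : 𝒟.A.KliftCont) (hSeam : 𝒟.A.Seam hKC) (hAdj : 𝒟.A.Adjoint)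
    (hKL : 𝒟.A.KliftLevel) (hKI : 𝒟.A.KliftIsotypic) (hΘσ : 𝒟.A.ThetaMemSigma)
    (hΘτ : 𝒟.A.ThetaTauType 𝒟.τiso) (hE : 𝒟.A.CopiesEquivariant) (hO : 𝒟.A.CopiesOrthogonal)
    (hIncl : 𝒟.A.CopiesIncl) (hTau : 𝒟.A.CopiesTauType) (hDec : 𝒟.A.TauTypeDecomposes)
    (hF : 𝒟.A.LevelPartFinite) (hC : 𝒟.A.LevelPartCont) (hAvg : 𝒟.A.KAverage)
    (hEq : 𝒟.A.ThetaEquivariant) (hSpan : 𝒟.A.SpanOfFixedVector) (hCO : 𝒟.A.CrossCopyOrthogonal)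
    (hInd : 𝒟.A.CopyIndependence) (hTS : 𝒟.A.TensorsSpan) :
    𝒟.A.hypI → 𝒟.A.hypII → 𝒟.ellNonzero 𝒟.A :=
  fun hI hII => 𝒟.A.propN_of_hyp 𝒟.τiso hKC hSeam hAdj hKL hKI hΘσ hΘτ hE hO hIncl hTau hDec hF hC
    hAvg hEq hSpan hCO hInd hTS hI hII

/-- N3B (Proposition N*, side B): the same statement on the side `W₃₄` / `π₀′`. -/
theorem N3B_of_datum (hKC : 𝒟.B.KliftCont) (hSeam : 𝒟.B.Seam hKC) (hAdj : 𝒟.B.Adjoint)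
    (hKL : 𝒟.B.KliftLevel) (hKI : 𝒟.B.KliftIsotypic) (hΘσ : 𝒟.B.ThetaMemSigma)
    (hΘτ : 𝒟.B.ThetaTauType 𝒟.τiso) (hE : 𝒟.B.CopiesEquivariant) (hO : 𝒟.B.CopiesOrthogonal)
    (hIncl : 𝒟.B.CopiesIncl) (hTau : 𝒟.B.CopiesTauType) (hDec : 𝒟.B.TauTypeDecomposes)
    (hF : 𝒟.B.LevelPartFinite) (hC : 𝒟.B.LevelPartCont) (hAvg : 𝒟.B.KAverage)
    (hEq : 𝒟.B.ThetaEquivariant) (hSpan : 𝒟.B.SpanOfFixedVector) (hCO : 𝒟.B.CrossCopyOrthogonal)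
    (hInd : 𝒟.B.CopyIndependence) (hTS : 𝒟.B.TensorsSpan) :
    𝒟.B.hypI → 𝒟.B.hypII → 𝒟.ellNonzero 𝒟.B :=
  fun hI hII => 𝒟.B.propN_of_hyp 𝒟.τiso hKC hSeam hAdj hKL hKI hΘσ hΘτ hE hO hIncl hTau hDec hF hC
    hAvg hEq hSpan hCO hInd hTS hI hII

/-- N3iso (TIER5 N3.L8, the assembly): `ℓ_A^σ ≢ 0 ∧ ℓ_B^σ ≢ 0 ⟹` some single pair of products
`F_A(φ_a, φ_b)`, `F_B(φ_c, φ_d)` has `⟨F_A, F_B⟩ ≠ 0` (Mathlib: `⟪F_B, F_A⟫_ℂ ≠ 0`), over the datum, with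
the N3.L8 interface binders and the side-B compatibility `Θ_V(π₀′) = σ` (N3 side B under (H_χ)). The
lead's `N3iso_main` turns the four Schwartz data into an admissible choice `c` through the choice
dictionary of `NAut` (STATUS l. 4747 (2)). -/
theorem N3iso_of_datum (hO : 𝒟.AutOrthogonal) (hst : 𝒟.AutStable) (hsimp : 𝒟.AutSimple)
    (hnon : 𝒟.AutNonIso hst) (hPX : 𝒟.ProductsIn20 𝒟.A) (hPeqX : 𝒟.ProductEquivariant 𝒟.A)
    (hPY : 𝒟.ProductsIn20 𝒟.B) (hPeqY : 𝒟.ProductEquivariant 𝒟.B) (hσX : 𝒟.SigmaIsAut 𝒟.A)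
    (hσ : 𝒟.B.σ = 𝒟.A.σ) :
    𝒟.ellNonzero 𝒟.A → 𝒟.ellNonzero 𝒟.B →
      ∃ (φa : 𝒟.A.Sa) (φb : 𝒟.A.Sb) (φc : 𝒟.B.Sa) (φd : 𝒟.B.Sb),
        ⟪𝒟.B.F φc φd, 𝒟.A.F φa φb⟫_ℂ ≠ 0 :=
  fun hA hB => 𝒟.exists_pairing_ne_zero hO hst hsimp hnon 𝒟.A 𝒟.B hPX hPeqX hPY hPeqY hσX hσ hA hB

end Summit.Ventures.HodgeRepro2.T6.N3Datum
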